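import Summits.CriticalPhenomena.PercolationContinuityZ3.Theorems.PercNearOneGluingNoHeavyQuantHeavyMixSingleGate
import HarnessLib

/-!
# QUANT lane R8, T-DEC, leg (III), general second factor of `SingleGateConvClosed`: a HEAVY-DECOMPOSABLE THREE-ATOM second factor is
# covered by CW — the explicit two-heavy-pair decomposition (companion of the light cells `SGCLightPair` / `SGCLightTriple`)

builds on p205010 (kernel theorem, internal audit signed; external expert review pending)

Support file (`--supports stmt-CriticalPhenomena-4575`), QUANT lane, TYPER seat prim-quant-stmt (gen 30), rung R8 of
`run/shared/lean/prim/quant/LADDER.md`.  Theorems only, standard axioms, no sorries, no definitions.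

A three-atom law `μ₂ = p₁δ_{s₁} + p₂δ_{s₂} + p₃δ_{s₃}` (`s₁ < s₂ < s₃`, `pᵢ > 0`, `Σ pᵢ = 1`, mean `T₂`) has a UNIQUE decomposition into
two-point laws of mean `T₂`: the pairs `(s₁,s₃), (s₂,s₃)` with top weights `(T₂−s₁)/(s₃−s₁) ≥ (T₂−s₂)/(s₃−s₂)` if `s₂ ≤ T₂`, and the pairs
`(s₁,s₂), (s₁,s₃)` with top weights `(T₂−s₁)/(s₂−s₁) ≥ (T₂−s₁)/(s₃−s₁)` if `T₂ < s₂`.  It is HEAVY-DECOMPOSABLE at `(y, q)` iff the smaller top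
weight is heavy: `s₂ ≤ T₂ → y(s₃−s₂) ≤ q(T₂−s₂)` and `T₂ < s₂ → y(s₃−s₁) ≤ q(T₂−s₁)` — the literal complement of the hypothesis of the cell
`SGCLightTriple` (typer g30, `…QuantSGCLightCells`).  For such a second factor the conclusion of `SingleGateConvClosed` follows from
`WindowMixDEC` by arm-2 g35's `singleGateConvClosed_heavyMix_of_windowMix` with two components; no DEC datum of `μ₂` is needed.

* `LawDec.triple_eq_twoPairs_low` / `LawDec.triple_eq_twoPairs_high` — the two decompositions as identities of laws.
* **`LawDec.singleGateConvClosed_tripleHD_of_windowMix`** — `WindowMixDEC →` SGC's conclusion for `(μ₁, μ₂)`, `μ₁` admissible, `μ₂` a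
  heavy-decomposable three-atom law with `s₃ ≤ M₂`.
HONEST STATUS: `SingleGateConvClosed`, `WindowMixDEC`, the light cells, `GateMove`, `TreeDEC`, `FarTreeRow` remain OPEN; RATE class log\* /
honest sentence unchanged.

[this work]; hook: prim-quant-arm-2 g35 (this lane).  Nothing here is cited as a published result.  The gluing rows served
[cite: KozmaNitzan2024, Conjecture 3 (p. 15)]; product measure [cite: Grimmett1999, §1.3 p. 10].
-/

noncomputable section

namespace Summit.CriticalPhenomena.PercolationContinuityZ3.Theorems

namespace Quant

open Finset

/-- two-point law notation `TP[lo, hi, g, h] = g·[h = hi] + (1 − g)·[h = lo]` (as in the lane's other files). -/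
local notation3 "TP[" lo ", " hi ", " g ", " h "]" =>
  (g : ℝ) * (if (h : ℕ) = (hi : ℕ) then (1 : ℝ) else 0) + (1 - (g : ℝ)) * (if (h : ℕ) = (lo : ℕ) then (1 : ℝ) else 0)

namespace LawDec

/-- **low decomposition** (`s₂ ≤ T₂`, in fact any `T₂ < s₃`): with `T₂ = p₁s₁ + p₂s₂ + p₃s₃`, `Σ pᵢ = 1`,
`p₁δ_{s₁} + p₂δ_{s₂} + p₃δ_{s₃} = w_A·{s₁, s₃; γ_A} + w_B·{s₂, s₃; γ_B}` with `γ_A = (T₂−s₁)/(s₃−s₁)`, `γ_B = (T₂−s₂)/(s₃−s₂)`,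
`w_A = p₁(s₃−s₁)/(s₃−T₂)`, `w_B = p₂(s₃−s₂)/(s₃−T₂)`. [this work] -/
theorem triple_eq_twoPairs_low (p₁ p₂ p₃ T₂ : ℝ) (s₁ s₂ s₃ : ℕ) (h12 : s₁ < s₂) (h23 : s₂ < s₃) (hp : p₁ + p₂ + p₃ = 1)
    (hT : p₁ * (s₁ : ℝ) + p₂ * (s₂ : ℝ) + p₃ * (s₃ : ℝ) = T₂) (hT3 : T₂ < (s₃ : ℝ)) (h : ℕ) :
    p₁ * (if h = s₁ then (1 : ℝ) else 0) + p₂ * (if h = s₂ then (1 : ℝ) else 0) + p₃ * (if h = s₃ then (1 : ℝ) else 0) =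
      p₁ * ((s₃ : ℝ) - s₁) / ((s₃ : ℝ) - T₂) * TP[s₁, s₃, (T₂ - s₁) / ((s₃ : ℝ) - s₁), h]
        + p₂ * ((s₃ : ℝ) - s₂) / ((s₃ : ℝ) - T₂) * TP[s₂, s₃, (T₂ - s₂) / ((s₃ : ℝ) - s₂), h] := by
  have hp3 : p₃ = 1 - p₁ - p₂ := by linarith
  subst hp3
  subst hT
  have d₁ : ((s₃ : ℝ) - s₁) ≠ 0 := by
    have : (s₁ : ℝ) < s₃ := by exact_mod_cast h12.trans h23
    linarith
  have d₂ : ((s₃ : ℝ) - s₂) ≠ 0 := by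
    have : (s₂ : ℝ) < s₃ := by exact_mod_cast h23
    linarith
  have d₃ : ((s₃ : ℝ) - (p₁ * (s₁ : ℝ) + p₂ * (s₂ : ℝ) + (1 - p₁ - p₂) * (s₃ : ℝ))) ≠ 0 := ne_of_gt (by linarith)
  have n12 : s₁ ≠ s₂ := by omega
  have n13 : s₁ ≠ s₃ := by omega
  have n23 : s₂ ≠ s₃ := by omega
  by_cases e₁ : h = s₁
  · subst e₁
    simp only [if_true, if_neg n12, if_neg n13]
    field_simp
    ring
  · by_cases e₂ : h = s₂
    · subst e₂
      simp only [if_true, if_neg e₁, if_neg n23]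
      field_simp
      ring
    · by_cases e₃ : h = s₃
      · subst e₃
        simp only [if_true, if_neg e₁, if_neg e₂]
        field_simp
        ring
      · simp only [if_neg e₁, if_neg e₂, if_neg e₃]
        ring

/-- **high decomposition** (`T₂ < s₂`, in fact any `s₁ < T₂`): `p₁δ_{s₁} + p₂δ_{s₂} + p₃δ_{s₃} = w′·{s₁, s₂; γ′} + w_A·{s₁, s₃; γ_A}` with
`γ′ = (T₂−s₁)/(s₂−s₁)`, `γ_A = (T₂−s₁)/(s₃−s₁)`, `w′ = p₂(s₂−s₁)/(T₂−s₁)`, `w_A = p₃(s₃−s₁)/(T₂−s₁)`. [this work] -/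
theorem triple_eq_twoPairs_high (p₁ p₂ p₃ T₂ : ℝ) (s₁ s₂ s₃ : ℕ) (h12 : s₁ < s₂) (h23 : s₂ < s₃) (hp : p₁ + p₂ + p₃ = 1)
    (hT : p₁ * (s₁ : ℝ) + p₂ * (s₂ : ℝ) + p₃ * (s₃ : ℝ) = T₂) (hT1 : (s₁ : ℝ) < T₂) (h : ℕ) :
    p₁ * (if h = s₁ then (1 : ℝ) else 0) + p₂ * (if h = s₂ then (1 : ℝ) else 0) + p₃ * (if h = s₃ then (1 : ℝ) else 0) =
      p₂ * ((s₂ : ℝ) - s₁) / (T₂ - s₁) * TP[s₁, s₂, (T₂ - s₁) / ((s₂ : ℝ) - s₁), h]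
        + p₃ * ((s₃ : ℝ) - s₁) / (T₂ - s₁) * TP[s₁, s₃, (T₂ - s₁) / ((s₃ : ℝ) - s₁), h] := by
  have hp1 : p₁ = 1 - p₂ - p₃ := by linarith
  subst hp1
  subst hT
  have d₁ : ((s₂ : ℝ) - s₁) ≠ 0 := by
    have : (s₁ : ℝ) < s₂ := by exact_mod_cast h12
    linarith
  have d₂ : ((s₃ : ℝ) - s₁) ≠ 0 := by
    have : (s₁ : ℝ) < s₃ := by exact_mod_cast h12.trans h23
    linarith
  have d₃ : ((1 - p₂ - p₃) * (s₁ : ℝ) + p₂ * (s₂ : ℝ) + p₃ * (s₃ : ℝ)) - (s₁ : ℝ) ≠ 0 := ne_of_gt (by linarith)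
  have n12 : s₁ ≠ s₂ := by omega
  have n13 : s₁ ≠ s₃ := by omega
  have n23 : s₂ ≠ s₃ := by omega
  by_cases e₁ : h = s₁
  · subst e₁
    simp only [if_true, if_neg n12, if_neg n13]
    field_simp
    ring
  · by_cases e₂ : h = s₂
    · subst e₂
      simp only [if_true, if_neg e₁, if_neg n23]
      field_simp
      ring
    · by_cases e₃ : h = s₃
      · subst e₃
        simp only [if_true, if_neg e₁, if_neg e₂]
        field_simp
        ring
      · simp only [if_neg e₁, if_neg e₂, if_neg e₃]
        ring

/-- **A HEAVY-DECOMPOSABLE TRIPLE IS COVERED BY CW.**  In SGC's binder for `μ₁` (floor `0 < y < 1`, gate `0 < q ≤ 1`, `μ₁` a nonnegative law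
on `{0..M₁}` of mass `1`, `gate_q μ₁` top-affordable and DEC at every layer `j′ < M₁`), let `μ₂ = p₁δ_{s₁} + p₂δ_{s₂} + p₃δ_{s₃}` with
`s₁ < s₂ < s₃ ≤ M₂`, `pᵢ > 0`, `Σ pᵢ = 1`, mean `T₂`, heavy-decomposable at `(y, q)`: `s₂ ≤ T₂ → y(s₃−s₂) ≤ q(T₂−s₂)` and
`T₂ < s₂ → y(s₃−s₁) ≤ q(T₂−s₁)`.  Then, given `WindowMixDEC`, `gate_q(μ₁ ∗ μ₂)` is DEC at every layer `j′ < M₁ + M₂` — SGC's conclusion —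
by `singleGateConvClosed_heavyMix_of_windowMix` on the two heavy pairs.  (No top-affordability or DEC datum of `μ₂` is used.)  Together with the
cell `SGCLightTriple` (the complementary hypothesis) this exhausts admissible three-atom second factors. [this work] -/
theorem singleGateConvClosed_tripleHD_of_windowMix (hCW : WindowMixDEC) (y q p₁ p₂ p₃ T₂ : ℝ) (M₁ M₂ s₁ s₂ s₃ : ℕ) (μ₁ : ℕ → ℝ)
    (hy0 : 0 < y) (hy1 : y < 1) (hq0 : 0 < q) (hq1 : q ≤ 1)
    (hμ0 : ∀ h, 0 ≤ μ₁ h) (hμM : ∀ h, M₁ < h → μ₁ h = 0) (hμ1 : ∑ h ∈ Finset.range (M₁ + 1), μ₁ h = 1)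
    (hta : y * (M₁ : ℝ) ≤ q * ∑ h ∈ Finset.range (M₁ + 1), (h : ℝ) * μ₁ h)
    (hD : ∀ j', j' < M₁ → DECAt y j' M₁ (gate μ₁ q))
    (h12 : s₁ < s₂) (h23 : s₂ < s₃) (h3 : s₃ ≤ M₂) (hp₁ : 0 < p₁) (hp₂ : 0 < p₂) (hp₃ : 0 < p₃) (hp : p₁ + p₂ + p₃ = 1)
    (hT : p₁ * (s₁ : ℝ) + p₂ * (s₂ : ℝ) + p₃ * (s₃ : ℝ) = T₂)
    (hHD : ((s₂ : ℝ) ≤ T₂ → y * ((s₃ : ℝ) - s₂) ≤ q * (T₂ - s₂)) ∧ (T₂ < (s₂ : ℝ) → y * ((s₃ : ℝ) - s₁) ≤ q * (T₂ - s₁))) :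
    ∀ j', j' < M₁ + M₂ → DECAt y j' (M₁ + M₂)
      (gate (lconv M₁ M₂ μ₁ (fun h => p₁ * (if h = s₁ then (1 : ℝ) else 0) + p₂ * (if h = s₂ then (1 : ℝ) else 0)
        + p₃ * (if h = s₃ then (1 : ℝ) else 0))) q) := by
  have hs12 : (s₁ : ℝ) < s₂ := by exact_mod_cast h12
  have hs23 : (s₂ : ℝ) < s₃ := by exact_mod_cast h23
  -- `s₁ < T₂ < s₃`
  have hT1 : (s₁ : ℝ) < T₂ := by
    have : p₁ * (s₁ : ℝ) + p₂ * (s₁ : ℝ) + p₃ * (s₁ : ℝ) < p₁ * (s₁ : ℝ) + p₂ * (s₂ : ℝ) + p₃ * (s₃ : ℝ) := by nlinarith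
    have e : p₁ * (s₁ : ℝ) + p₂ * (s₁ : ℝ) + p₃ * (s₁ : ℝ) = s₁ := by rw [← add_mul, ← add_mul, hp, one_mul]
    linarith
  have hT3 : T₂ < (s₃ : ℝ) := by
    have : p₁ * (s₁ : ℝ) + p₂ * (s₂ : ℝ) + p₃ * (s₃ : ℝ) < p₁ * (s₃ : ℝ) + p₂ * (s₃ : ℝ) + p₃ * (s₃ : ℝ) := by nlinarith
    have e : p₁ * (s₃ : ℝ) + p₂ * (s₃ : ℝ) + p₃ * (s₃ : ℝ) = s₃ := by rw [← add_mul, ← add_mul, hp, one_mul]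
    linarith
  by_cases hcase : (s₂ : ℝ) ≤ T₂
  · -- low decomposition: pairs `(s₁,s₃)` [true] and `(s₂,s₃)` [false]
    have hheavyB : y * ((s₃ : ℝ) - s₂) ≤ q * (T₂ - s₂) := hHD.1 hcase
    have h := singleGateConvClosed_heavyMix_of_windowMix hCW y q T₂ M₁ M₂ μ₁ (ι := Bool)
      (fun b => if b then p₁ * ((s₃ : ℝ) - s₁) / ((s₃ : ℝ) - T₂) else p₂ * ((s₃ : ℝ) - s₂) / ((s₃ : ℝ) - T₂))
      (fun b => if b then (T₂ - s₁) / ((s₃ : ℝ) - s₁) else (T₂ - s₂) / ((s₃ : ℝ) - s₂))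
      (fun b => if b then s₁ else s₂) (fun _ => s₃) hy0 hy1 hq0 hq1 hμ0 hμM hμ1 hta hD
      (by
        intro b; cases b
        · simp only [Bool.false_eq_true, if_false]
          exact div_nonneg (mul_nonneg hp₂.le (by linarith)) (by linarith)
        · simp only [if_true]
          exact div_nonneg (mul_nonneg hp₁.le (by linarith)) (by linarith))
      (by
        rw [Fintype.sum_bool]; simp only [if_true, Bool.false_eq_true, if_false]
        have d₃ : ((s₃ : ℝ) - T₂) ≠ 0 := ne_of_gt (by linarith)
        field_simp
        linear_combination (s₃ : ℝ) * hp - hT)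
      (by
        intro b; cases b
        · simp only [Bool.false_eq_true, if_false]
          rw [div_le_one (by linarith)]; linarith
        · simp only [if_true]
          rw [div_le_one (by linarith)]; linarith)
      (by
        intro b; cases b
        · simp only [Bool.false_eq_true, if_false]
          rw [← mul_div_assoc, le_div_iff₀ (by linarith)]; linarith
        · simp only [if_true]
          rw [← mul_div_assoc, le_div_iff₀ (by linarith)]
          -- `γ_A ≥ γ_B`: `y(s₃ − s₁) ≤ q(T₂ − s₁)` from `y(s₃ − s₂) ≤ q(T₂ − s₂)`, `y < 1`? no: from `(s₂−s₁)(s₃−T₂) ≥ 0` and `y ≤ q`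
          -- we use: y(s₃−s₁) = y(s₃−s₂) + y(s₂−s₁) ≤ q(T₂−s₂) + q(s₂−s₁) = q(T₂−s₁), needing `y ≤ q`, which follows from
          -- `y(s₃−s₂) ≤ q(T₂−s₂) ≤ q(s₃−s₂)` with `s₃ − s₂ > 0`.
          have hyq : y ≤ q := by
            have h1 : q * (T₂ - s₂) ≤ q * ((s₃ : ℝ) - s₂) := mul_le_mul_of_nonneg_left (by linarith) hq0.le
            nlinarith
          nlinarith)
      (by intro b; cases b <;> simp only [Bool.false_eq_true, if_false, if_true] <;> omega)
      (fun _ => h3)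
      (by
        intro b; cases b
        · simp only [Bool.false_eq_true, if_false]
          rw [mul_div_cancel₀ _ (show ((s₃ : ℝ) - s₂) ≠ 0 from ne_of_gt (by linarith))]; ring
        · simp only [if_true]
          rw [mul_div_cancel₀ _ (show ((s₃ : ℝ) - s₁) ≠ 0 from ne_of_gt (by linarith))]; ring)
    have e : (fun h => ∑ b : Bool,
        (if b then p₁ * ((s₃ : ℝ) - s₁) / ((s₃ : ℝ) - T₂) else p₂ * ((s₃ : ℝ) - s₂) / ((s₃ : ℝ) - T₂)) *
          TP[if b then s₁ else s₂, s₃, if b then (T₂ - s₁) / ((s₃ : ℝ) - s₁) else (T₂ - s₂) / ((s₃ : ℝ) - s₂), h]) =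
        (fun h => p₁ * (if h = s₁ then (1 : ℝ) else 0) + p₂ * (if h = s₂ then (1 : ℝ) else 0)
          + p₃ * (if h = s₃ then (1 : ℝ) else 0)) := by
      funext h
      rw [Fintype.sum_bool]; simp only [if_true, Bool.false_eq_true, if_false]
      rw [triple_eq_twoPairs_low p₁ p₂ p₃ T₂ s₁ s₂ s₃ h12 h23 hp hT hT3 h]
    rw [← e]; exact h
  · -- high decomposition: pairs `(s₁,s₂)` [true] and `(s₁,s₃)` [false]
    rw [not_le] at hcase
    have hheavyA : y * ((s₃ : ℝ) - s₁) ≤ q * (T₂ - s₁) := hHD.2 hcase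
    have h := singleGateConvClosed_heavyMix_of_windowMix hCW y q T₂ M₁ M₂ μ₁ (ι := Bool)
      (fun b => if b then p₂ * ((s₂ : ℝ) - s₁) / (T₂ - s₁) else p₃ * ((s₃ : ℝ) - s₁) / (T₂ - s₁))
      (fun b => if b then (T₂ - s₁) / ((s₂ : ℝ) - s₁) else (T₂ - s₁) / ((s₃ : ℝ) - s₁))
      (fun _ => s₁) (fun b => if b then s₂ else s₃) hy0 hy1 hq0 hq1 hμ0 hμM hμ1 hta hD
      (by
        intro b; cases b
        · simp only [Bool.false_eq_true, if_false]
          exact div_nonneg (mul_nonneg hp₃.le (by linarith)) (by linarith)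
        · simp only [if_true]
          exact div_nonneg (mul_nonneg hp₂.le (by linarith)) (by linarith))
      (by
        rw [Fintype.sum_bool]; simp only [if_true, Bool.false_eq_true, if_false]
        have d₃ : (T₂ - (s₁ : ℝ)) ≠ 0 := ne_of_gt (by linarith)
        field_simp
        linear_combination hT - (s₁ : ℝ) * hp)
      (by
        intro b; cases b
        · simp only [Bool.false_eq_true, if_false]
          rw [div_le_one (by linarith)]; linarith
        · simp only [if_true]
          rw [div_le_one (by linarith)]; linarith)
      (by
        intro b; cases b
        · simp only [Bool.false_eq_true, if_false]
          rw [← mul_div_assoc, le_div_iff₀ (by linarith)]; linarith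
        · simp only [if_true]
          rw [← mul_div_assoc, le_div_iff₀ (by linarith)]
          -- `γ′ ≥ γ_A`: y(s₂−s₁) ≤ q(T₂−s₁) from y(s₃−s₁) ≤ q(T₂−s₁) and s₂ < s₃
          nlinarith)
      (by intro b; cases b <;> simp only [Bool.false_eq_true, if_false, if_true] <;> omega)
      (by intro b; cases b <;> simp only [Bool.false_eq_true, if_false, if_true] <;> omega)
      (by
        intro b; cases b
        · simp only [Bool.false_eq_true, if_false]
          rw [mul_div_cancel₀ _ (show ((s₃ : ℝ) - s₁) ≠ 0 from ne_of_gt (by linarith))]; ring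
        · simp only [if_true]
          rw [mul_div_cancel₀ _ (show ((s₂ : ℝ) - s₁) ≠ 0 from ne_of_gt (by linarith))]; ring)
    have e : (fun h => ∑ b : Bool,
        (if b then p₂ * ((s₂ : ℝ) - s₁) / (T₂ - s₁) else p₃ * ((s₃ : ℝ) - s₁) / (T₂ - s₁)) *
          TP[s₁, if b then s₂ else s₃, if b then (T₂ - s₁) / ((s₂ : ℝ) - s₁) else (T₂ - s₁) / ((s₃ : ℝ) - s₁), h]) =
        (fun h => p₁ * (if h = s₁ then (1 : ℝ) else 0) + p₂ * (if h = s₂ then (1 : ℝ) else 0)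
          + p₃ * (if h = s₃ then (1 : ℝ) else 0)) := by
      funext h
      rw [Fintype.sum_bool]; simp only [if_true, Bool.false_eq_true, if_false]
      rw [triple_eq_twoPairs_high p₁ p₂ p₃ T₂ s₁ s₂ s₃ h12 h23 hp hT hT1 h]
    rw [← e]; exact h

end LawDec

end Quant

end Summit.CriticalPhenomena.PercolationContinuityZ3.Theorems
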